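import Summits.BirchSwinnertonDyer.BirchSwinnertonDyer.Theses.UniversalToricDescent
import Summits.BirchSwinnertonDyer.BirchSwinnertonDyer.Theorems.UniversalToricDescentToricTransportModThreeStubRatSqueeze
import Summits.BirchSwinnertonDyer.BirchSwinnertonDyer.Theorems.UniversalToricDescentAcDualMuZeroCriterion
import Summits.BirchSwinnertonDyer.BirchSwinnertonDyer.Theorems.UniversalToricDescentRationalSplitIMCInclusionAtThreeOfWall
import Summits.BirchSwinnertonDyer.BirchSwinnertonDyer.Theorems.UniversalToricDescentCharIdealVacuity
import Literature.NumberTheory.EllipticCurves.KatoFineSelmerDual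
import HarnessLib

/-!
# Crux `AdditiveSplitIMCInclusionAtThree` (stmt-BirchSwinnertonDyer-20395) — node `symplectic_isotropy_cut`
# (crux-ideate cover g17; UNREGISTERED node, `sorry` only in `stub_*`; concludes the crux BY NAME)

SYMPLECTIC ISOTROPY CUT.  The wall `= RATWALL ∧ (μ-half)` (g7 `wall_iff_ratwall_and_muDominance`; g8/g10/g14
`wall_of_ratwall_of_residualFinite`), and on the closes locus its surplus over RATWALL (24207) is exactly
`μ(X_(∅,0)(E/K_∞)) = 0` (B-g12-2).  Every earlier idea for the μ-half CONSTRUCTS something at the additive split prime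
(Heegner/Kolyvagin classes — `Tr y_{m+1} = 0`, barrier `TraceZeroHeegnerTowerAtAdditiveSplitP`; admissible primes —
`NoAdmissiblePrimesAtThree`; congruence twins — `24737`).  This node constructs NOTHING: it reads the residual module
`V := Sel_(∅ at 𝔭, 0 at 𝔭′)(K_∞, E[3^∞])[3]` (an `Ω = 𝔽₃⟦T⟧`-module, `V^∨ = X_(∅,0)/3`) through two pieces of pure
Galois-cohomological DUALITY in which the reduction type of `E` at `3` never enters, because the local conditions
of the conjugate pair at the two primes above `3` are the TRIVIAL Greenberg conditions `T` and `0`: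

* **ISO** (`IsotropyGrowthAtThree`): Poitou–Tate ISOTROPY at `𝔭` — `loc_𝔭 Sel_(∅,0)(K_n, E[3])` is totally isotropic for
  `Σ_{w∣𝔭} inv_w(· ∪_Weil ·)` (sum of local invariants vanishes; the classes die at `w ∣ 𝔭′` and are Lagrangian at
  `w ∤ 3`), a non-degenerate form on `⊕_{w∣𝔭} H¹(K_{n,w}, E[3])` of dimension `2·3^n + O(1)`; so
  `dim Sel_(∅,0)(K_n) ≤ dim Sel_(0,0)(K_n) + 3^n + O(1)`, and with control (`E(K_∞)[3] = 0`, `E(K_{∞,𝔭′})[3^∞]` finite)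
  `#V^{γ^{3^n}} ≤ 3^{3^n + C}` once the residual FINE Selmer group `Sel₀(K_∞, E[3^∞])[3]` is finite (FINE).
* **SYMP** (`SymplecticGrowthAtThree`): Nekovář's generalized Cassels–Tate duality pairs `H̃²_f(T; ℱ)_tors` with
  `H̃²_f(T; ℱ^⊥)_tors^ι` over `Λ` for Greenberg local conditions `ℱ`; for the conjugate pair `ℱ = (T at 𝔭, 0 at 𝔭′)`,
  `ℱ^⊥ = τℱ` and transport by complex conjugation `τ` (`τγτ⁻¹ = γ⁻¹` on the anticyclotomic `Γ`) identifies
  `H̃_f(T; τℱ) ≅ H̃_f(T; ℱ)^ι`, giving a non-degenerate skew-symmetric BILINEAR form on `(X_(∅,0))_tors` localized at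
  EVERY height-one prime INCLUDING `(3)` [Nekovář, Selmer Complexes, 0.15.3 + 10.7.12 + 10.7.18: "everything works
  even for 𝔭 = (p)" under (Heeg), the only extra hypothesis 10.7.11.4 being vacuous]; hence
  `(X_(∅,0))_tors ~ M ⊕ M` modulo pseudo-null and the number `s` of `μ`-summands `Λ/3^a` is EVEN: on the torsion locus
  `#V^{γ^{3^n}} = 3^{s·3^n + O(1)}` with `s` even.
* KERNEL (this file, no sorry): `s·3^n ≤ 3^n + C` for all `n` forces `s ≤ 1`; `s` even forces `s = 0`; so
  `#V^{γ^{3^n}}` is BOUNDED; **EXH** (`FiniteOfBoundedInvariantsAtThree`, discrete `Γ`-module exhaustion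
  `V = ⋃_n V^{γ^{3^n}}`) gives `V` finite; the LANDED receptacle
  `UniversalToricDescentAcDualMuZero.isTorsion_and_exists_generator_of_finite_pTorsion` gives `Ch·R₀⟦T⟧ = (g)` with a
  unit coefficient; `3 ∤ g` and RATWALL `3^k L ∈ (g)` give `(L) ⊆ (g)` (g10 kernel road verbatim).  OFF the torsion
  locus the wall is VACUOUS (`UniversalToricDescentCharIdealVacuity.span_le_map_charIdeal_of_not_isTorsion`, landed).

NET REDUCTION (pencil, pieces ISO/SYMP/EXH theorem-shaped): **μ-half of the wall ⟸ FINE**, i.e.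
`WALL ⟸ RATWALL ∧ [Sel₀(K_∞^{ac}, E[3^∞])[3] finite]` — the anticyclotomic residual Conjecture A for `E` itself, a
statement blind to the local type at `3` (fine classes vanish at both primes above `3`), with engines in the tree
(`finite_fineSelmerInfty_of_forall_equivariantHom_classGroup_eq_zero`, isotypic class-group criterion) and strictly
weaker than the μ-half (`fineTorsionFinite_of_selmerAcTorsionFinite` below, kernel).

PIECES / TAGS (evidence in `Lines/symplectic_isotropy_cut.md`):
* `stub_ratwall : RationalSplitIMCInclusionAtThree` — WEAKER (kernel: `rationalSplitIMCInclusionAtThree_of_wall`,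
  landed; converse open) · leaf = crux 24207 (LEAD `thin_comb`), ATTACKABLE.
* `stub_fine : FineResidualFiniteAtThreeSurj` — WEAKER than the μ-half framewise (kernel
  `fineTorsionFinite_of_selmerAcTorsionFinite`); vs the crux alone not kernel-comparable · leaf IDEA-NEEDED /
  INSTRUMENTABLE (isotypic class-group criterion per instance; Matar layer-0 criterion).
* `stub_isotropyGrowth : IsotropyGrowthAtThree` — UNDECIDED→ATTACKABLE (pencil-proved: Poitou–Tate sum formula +
  two control lemmas; M-sized port).
* `stub_symplecticGrowth : SymplecticGrowthAtThree` — UNDECIDED→ATTACKABLE (print-adjacent L-port of Nekovář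
  10.7.12 to the conjugate pair; the additive type at `3` is irrelevant to it).
* `stub_finiteOfBoundedInvariants : FiniteOfBoundedInvariantsAtThree` — ATTACKABLE (S: stabilisers of a discrete
  module are open; `finite_setOf_selmerAc_pTorsion_conjH1_eq` is the `n = 0` case in the tree).
Shred check: 5 stubs, each ≥ M except EXH (S, genuine); none restates the crux (ISO/SYMP/EXH hold or fail
independently of `L`; FINE omits `𝔭′`, `L`, `Ch`); costume check: no stub mentions `charIdeal` or `L` except RATWALL
(a route crux).  Disproof.lean: none on file for 20395 (checked g17).  Negatives 15532/24881: disjoint vocabulary.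
-/

set_option linter.dupNamespace false
set_option autoImplicit false

noncomputable section

open scoped Classical NumberField
open NumberField IsDedekindDomain Field WeierstrassCurve
open Literature.NumberTheory.EllipticCurves Literature.NumberTheory.EllipticCurves.IwasawaAlgebra
open Literature.NumberTheory.EllipticCurves.ZpExtension Literature.NumberTheory.EllipticCurves.GreenbergSelmer
open Summit.BirchSwinnertonDyer.Rank1Residual.X11b Summit.BirchSwinnertonDyer.Rank1Residual.X11b.AcSelmer
open Summit.BirchSwinnertonDyer.BirchSwinnertonDyer.Theses.UniversalToricDescent
  (RationalSplitIMCInclusionAtThree AdditiveSplitIMCInclusionAtThree)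
open Summit.BirchSwinnertonDyer.BirchSwinnertonDyer.Cruxes.ToricTransportModThree.RatwallThinComb
  (dvd_of_dvd_prime_pow_mul prime_C_three not_C_three_dvd_of_norm_coeff_eq_one)
open Summit.BirchSwinnertonDyer.BirchSwinnertonDyer.Theorems.UniversalToricDescentAcDualMuZero
  (isTorsion_and_exists_generator_of_finite_pTorsion)
open Summit.BirchSwinnertonDyer.BirchSwinnertonDyer.Theorems.UniversalToricDescentCharIdealVacuity
  (span_le_map_charIdeal_of_not_isTorsion)

namespace Summit.BirchSwinnertonDyer.BirchSwinnertonDyer.Cruxes.AdditiveSplitIMCInclusionAtThree.SymplecticIsotropyCut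

/-! ## §0 The μ-half of the wall (verbatim g8/g10/g14 text) and its torsion-locus form -/

/-- μ-half (UNDECIDED; identical text to g8 `DivisionTowerMuFloor` / g10 / g14): residual `(∅,0)`-Selmer finiteness
`Sel_{𝔭′-strict}(K_∞, E[3^∞])[3]` finite on the O6 / onto / `r_an = 1` rows. [cite: GreenbergVatsal2000, §2 Prop. (2.8)] -/
def ResidualSelmerFiniteAtThreeSurj : Prop :=
  ∀ (W : WeierstrassCurve ℚ) [W.IsElliptic] [W.IsGloballyMinimal] (N : ℕ) [NeZero N]
    (K : Type) [Field K] [NumberField K],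
    Summit.BirchSwinnertonDyer.Rank1Residual.Additive.ClassO6 W 3 → W.HasSurjectiveModNGaloisRep 3 →
    W.analyticRank = 1 → W.conductorNorm ℤ = N →
    IsImaginaryQuadratic K → SatisfiesHeegnerHypothesis N K →
    ∀ (κ : ZpExtension K 3), κ.IsAnticyclotomic →
    ∀ (𝔭' : HeightOneSpectrum (𝓞 K)), ((3 : ℕ) : 𝓞 K) ∈ 𝔭'.asIdeal →
      Set.Finite {s : selmerAc (W.baseChange K) 3 κ 𝔭' ∅ | (3 : ℕ) • s = 0}

/-- μ-half ON THE TORSION LOCUS (what the pieces deliver; the wall is vacuous off it): for a topological generator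
`γ`, if `X_(∅,0) = XAc (W.baseChange K) 3 κ 𝔭′ ∅ γ` is `Λ`-torsion then `Sel_(∅,0)(K_∞, E[3^∞])[3]` is finite.
[cite: GreenbergVatsal2000, §2 Prop. (2.8)] [cite: Washington1997, §13.2] -/
def ResidualFiniteOnTorsionLocusAtThree : Prop :=
  ∀ (W : WeierstrassCurve ℚ) [W.IsElliptic] [W.IsGloballyMinimal] (N : ℕ) [NeZero N]
    (K : Type) [Field K] [NumberField K],
    Summit.BirchSwinnertonDyer.Rank1Residual.Additive.ClassO6 W 3 → W.HasSurjectiveModNGaloisRep 3 →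
    W.analyticRank = 1 → W.conductorNorm ℤ = N →
    IsImaginaryQuadratic K → SatisfiesHeegnerHypothesis N K →
    ∀ (κ : ZpExtension K 3), κ.IsAnticyclotomic →
    ∀ (γ : absoluteGaloisGroup K) [Fact (κ.IsTopGenerator γ)]
      (𝔭' : HeightOneSpectrum (𝓞 K)), ((3 : ℕ) : 𝓞 K) ∈ 𝔭'.asIdeal →
      Module.IsTorsion (IwasawaAlgebra 3) (XAc (W.baseChange K) 3 κ 𝔭' ∅ γ) →
      Set.Finite {s : selmerAc (W.baseChange K) 3 κ 𝔭' ∅ | (3 : ℕ) • s = 0}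

/-! ## §1 The residual invariants `V^{γ^{3^n}}` (tree objects only) -/

/-- `V_n := (Sel_(∅ at 𝔭, 0 at 𝔭′)(K_∞, E[3^∞])[3])^{γ^{3^n}}` — the `3`-torsion classes of Castella's anticyclotomic
Selmer group (strict above `𝔭′`, no condition above the other prime) fixed by `conj_{γ^{3^n}}`, as a set.
As an `Ω = 𝔽₃⟦T⟧`-module `V[ω_n] = V[T^{3^n}]`, so `#V_n = 3^{(r+s)·3^n + O(1)}` with `r + s` the `Ω`-corank of `V`.
[cite: Castella2018, Def. 2.2] [cite: Washington1997, §13.2] -/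
def InvSet {K : Type} [Field K] [NumberField K] (W : WeierstrassCurve K) (κ : ZpExtension K 3)
    (𝔭' : HeightOneSpectrum (𝓞 K)) (γ : absoluteGaloisGroup K) (n : ℕ) : Set (selmerAc W 3 κ 𝔭' ∅) :=
  {s | (3 : ℕ) • s = 0 ∧ W.conjH1 3 κ.kerSubgroup (γ ^ 3 ^ n) (s : W.subgroupH1 3 κ.kerSubgroup) = s}

/-! ## §2 The pieces (Props) -/

/-- **FINE** (WEAKER than the μ-half framewise; leaf IDEA-NEEDED / INSTRUMENTABLE): the residual FINE Selmer group
`Sel₀(K_∞, E[3^∞])[3]` over the anticyclotomic tower is finite on the O6 / onto / `r_an = 1` rows — residual form of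
the anticyclotomic Conjecture A for `E` at `3` (fine classes vanish at BOTH primes above `3`: blind to the additive
type).  Engines: isotypic class-group criterion `finite_fineSelmerInfty_of_forall_equivariantHom_classGroup_eq_zero`
(tree), Matar's layer-0 criterion. [cite: Kim2022StructureSelmer, §1.2.4 and Conj. 1.3] [cite: Greenberg1989, §1 p. 98] -/
def FineResidualFiniteAtThreeSurj : Prop :=
  ∀ (W : WeierstrassCurve ℚ) [W.IsElliptic] [W.IsGloballyMinimal] (N : ℕ) [NeZero N]
    (K : Type) [Field K] [NumberField K],
    Summit.BirchSwinnertonDyer.Rank1Residual.Additive.ClassO6 W 3 → W.HasSurjectiveModNGaloisRep 3 →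
    W.analyticRank = 1 → W.conductorNorm ℤ = N →
    IsImaginaryQuadratic K → SatisfiesHeegnerHypothesis N K →
    ∀ (κ : ZpExtension K 3), κ.IsAnticyclotomic →
      Set.Finite {s : (W.baseChange K).fineSelmerInfty κ | (3 : ℕ) • s = 0}

/-- **ISO — Poitou–Tate isotropy growth bound** (UNDECIDED→ATTACKABLE, pencil-proved): if the residual fine Selmer
group is finite then `#V^{γ^{3^n}} ≤ 3^{3^n + C}` (`Ω`-corank of `V` at most `1`): `loc_𝔭 Sel_(∅,0)(K_n, E[3])` is
totally isotropic for the sum of local invariants of the Weil cup product on `⊕_{w∣𝔭} H¹(K_{n,w}, E[3])`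
(`dim = 2·3^n + O(1)`), its kernel is `Sel_(0,0)(K_n, E[3]) ⊇`-controlled by the fine group, and
`H¹(K_n, E[3]) = H¹(K_∞, E[3])^{Γ_n}` (`E(K_∞)[3] = 0`), `E(K_{∞,𝔭′})[3^∞]` finite (potentially supersingular,
locally irreducible). [cite: Greenberg1989, §1 p. 98] [cite: Castella2018, Def. 2.2] -/
def IsotropyGrowthAtThree : Prop :=
  ∀ (W : WeierstrassCurve ℚ) [W.IsElliptic] [W.IsGloballyMinimal] (N : ℕ) [NeZero N]
    (K : Type) [Field K] [NumberField K],
    Summit.BirchSwinnertonDyer.Rank1Residual.Additive.ClassO6 W 3 → W.HasSurjectiveModNGaloisRep 3 →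
    W.analyticRank = 1 → W.conductorNorm ℤ = N →
    IsImaginaryQuadratic K → SatisfiesHeegnerHypothesis N K →
    ∀ (κ : ZpExtension K 3), κ.IsAnticyclotomic →
    ∀ (γ : absoluteGaloisGroup K) [Fact (κ.IsTopGenerator γ)]
      (𝔭' : HeightOneSpectrum (𝓞 K)), ((3 : ℕ) : 𝓞 K) ∈ 𝔭'.asIdeal →
      Set.Finite {s : (W.baseChange K).fineSelmerInfty κ | (3 : ℕ) • s = 0} →
      ∃ C : ℕ, ∀ n : ℕ, (InvSet (W.baseChange K) κ 𝔭' γ n).Finite ∧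
        Nat.card (InvSet (W.baseChange K) κ 𝔭' γ n) ≤ 3 ^ (3 ^ n + C)

/-- **SYMP — Nekovář's dihedral symplectic structure, conjugate-pair form** (UNDECIDED→ATTACKABLE, print-adjacent):
on the torsion locus `(X_(∅,0))_tors ~ M ⊕ M` modulo pseudo-null at every height-one prime INCLUDING `(3)` (generalized
Cassels–Tate duality `H̃²_f(T;ℱ)_tors × H̃²_f(T;ℱ^⊥)_tors^ι → Frac Λ/Λ` for the Greenberg pair `ℱ = (T, 0)`,
`ℱ^⊥ = τℱ`, transported by `τ`; skew-symmetric, `2 ∈ Λ^×`), so the number `s` of `μ`-summands is EVEN and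
`#V^{γ^{3^n}} = 3^{s·3^n + O(1)}` two-sidedly. Source: Nekovář, Selmer Complexes (Astérisque 310) 0.15.3, 10.7.12,
10.7.18. [cite: Greenberg1989, §1 p. 98] [cite: Washington1997, §13.2] -/
def SymplecticGrowthAtThree : Prop :=
  ∀ (W : WeierstrassCurve ℚ) [W.IsElliptic] [W.IsGloballyMinimal] (N : ℕ) [NeZero N]
    (K : Type) [Field K] [NumberField K],
    Summit.BirchSwinnertonDyer.Rank1Residual.Additive.ClassO6 W 3 → W.HasSurjectiveModNGaloisRep 3 →
    W.analyticRank = 1 → W.conductorNorm ℤ = N →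
    IsImaginaryQuadratic K → SatisfiesHeegnerHypothesis N K →
    ∀ (κ : ZpExtension K 3), κ.IsAnticyclotomic →
    ∀ (γ : absoluteGaloisGroup K) [Fact (κ.IsTopGenerator γ)]
      (𝔭' : HeightOneSpectrum (𝓞 K)), ((3 : ℕ) : 𝓞 K) ∈ 𝔭'.asIdeal →
      Module.IsTorsion (IwasawaAlgebra 3) (XAc (W.baseChange K) 3 κ 𝔭' ∅ γ) →
      ∃ s C : ℕ, Even s ∧ ∀ n : ℕ, (InvSet (W.baseChange K) κ 𝔭' γ n).Finite ∧
        3 ^ (s * 3 ^ n) ≤ Nat.card (InvSet (W.baseChange K) κ 𝔭' γ n) * 3 ^ C ∧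
        Nat.card (InvSet (W.baseChange K) κ 𝔭' γ n) ≤ 3 ^ (s * 3 ^ n + C)

/-- **EXH — exhaustion of a discrete `Γ`-module by invariants** (ATTACKABLE, S-sized): every class of
`Sel(K_∞, E[3^∞]) ⊂ H¹(K_∞, E[3^∞])` is fixed by `conj_{γ^{3^n}}` for `n ≫ 0` (inflated from some layer `K_n`), so if
`#V^{γ^{3^n}} ≤ 3^C` for all `n` then `V = Sel_(∅,0)(K_∞, E[3^∞])[3]` is finite. [cite: Greenberg1989, §1 p. 98] -/
def FiniteOfBoundedInvariantsAtThree : Prop :=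
  ∀ (K : Type) [Field K] [NumberField K] (W : WeierstrassCurve K) [W.IsElliptic] (κ : ZpExtension K 3)
    (γ : absoluteGaloisGroup K) [Fact (κ.IsTopGenerator γ)] (𝔭' : HeightOneSpectrum (𝓞 K)),
    (∃ C : ℕ, ∀ n : ℕ, (InvSet W κ 𝔭' γ n).Finite ∧ Nat.card (InvSet W κ 𝔭' γ n) ≤ 3 ^ C) →
      Set.Finite {s : selmerAc W 3 κ 𝔭' ∅ | (3 : ℕ) • s = 0}

/-! ## §3 Kernel-checked evidence (no `sorry`) -/

/-- `Sel₀(K_∞, E[p^∞]) ≤ Sel_(∅ at the other prime, 0 at 𝔭)(K_∞, E[p^∞])` (the g8 / 24737-g14 lemma, verbatim):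
the fine datum is contained in Castella's datum strict above `𝔭`. [cite: Greenberg1989, §1 p. 98] [cite: Castella2018, Def. 2.2] -/
theorem fineSelmerInfty_le_selmerAc {K : Type} [Field K] [NumberField K] (W : WeierstrassCurve K) (p : ℕ)
    [Fact p.Prime] (κ : ZpExtension K p) (𝔭 : HeightOneSpectrum (𝓞 K)) (h𝔭 : ((p : ℕ) : 𝓞 K) ∈ 𝔭.asIdeal)
    (S : Set (HeightOneSpectrum (𝓞 K))) :
    W.fineSelmerInfty κ ≤ selmerAc W p κ 𝔭 S := by
  intro c hc
  have hc' := (mem_strictSelmerGroupOver_iff c).mp hc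
  exact (mem_selmerOver_iff c).mpr
    ⟨fun v hv _ σ ↦ hc'.1 v hv σ, hc'.2.1, fun σ ↦ hc'.2.2 𝔭 h𝔭 σ⟩

/-- Finiteness of the `n`-torsion passes to a smaller additive subgroup (verbatim the g8 lemma). [folklore] -/
theorem finite_nsmul_eq_zero_of_le {A : Type*} [AddCommGroup A] {B C : AddSubgroup A} (hle : B ≤ C) (n : ℕ)
    (h : Set.Finite {s : C | n • s = 0}) : Set.Finite {s : B | n • s = 0} := by
  let ι : B → C := fun s ↦ ⟨s.1, hle s.2⟩
  have hι : Function.Injective ι := by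
    intro a b hab
    apply Subtype.ext
    have h1 : ((ι a : C) : A) = ((ι b : C) : A) := congrArg Subtype.val hab
    exact h1
  refine Set.Finite.of_finite_image (h.subset ?_) hι.injOn
  rintro _ ⟨s, hs, rfl⟩
  have hs' : n • (s : A) = 0 := by
    have h1 := congrArg Subtype.val hs
    simpa using h1
  show n • ι s = 0
  exact Subtype.ext (by simpa [ι] using hs')

/-- **FINE is WEAKER than the μ-half, frame by frame** (kernel): `Sel_(∅,0)(K_∞,E[3^∞])[3]` finite ⟹
`Sel₀(K_∞,E[3^∞])[3]` finite. [cite: Greenberg1989, §1 p. 98] -/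
theorem fineTorsionFinite_of_selmerAcTorsionFinite {K : Type} [Field K] [NumberField K] (W : WeierstrassCurve K)
    (κ : ZpExtension K 3) (𝔭' : HeightOneSpectrum (𝓞 K)) (h𝔭' : ((3 : ℕ) : 𝓞 K) ∈ 𝔭'.asIdeal)
    (h : Set.Finite {s : selmerAc W 3 κ 𝔭' ∅ | (3 : ℕ) • s = 0}) :
    Set.Finite {s : W.fineSelmerInfty κ | (3 : ℕ) • s = 0} :=
  finite_nsmul_eq_zero_of_le (fineSelmerInfty_le_selmerAc W 3 κ 𝔭' h𝔭' ∅) 3 h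

/-- A growth rate `s` with `s·3^n ≤ 3^n + C` for all `n` is at most `1`. [folklore] -/
theorem rate_le_one {s C : ℕ} (h : ∀ n : ℕ, s * 3 ^ n ≤ 3 ^ n + C) : s ≤ 1 := by
  by_contra hs
  have hs2 : 2 ≤ s := by omega
  have hC : C < 3 ^ C := Nat.lt_pow_self (by norm_num : 1 < 3)
  have h1 := h C
  have h2 : 2 * 3 ^ C ≤ s * 3 ^ C := Nat.mul_le_mul_right _ hs2
  omega

/-- An even natural number `≤ 1` is `0` — the residual shadow of «`s` even (SYMP) and `s ≤ 1` (ISO) force `μ = 0`». [folklore] -/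
theorem eq_zero_of_even_of_le_one {s : ℕ} (he : Even s) (hs : s ≤ 1) : s = 0 := by
  obtain ⟨t, rfl⟩ := he
  omega

/-- **The squeeze** (kernel): an upper growth bound of rate `1` (ISO) and a two-sided growth of EVEN rate `s` (SYMP)
force `s = 0`, hence BOUNDED invariants. [folklore] -/
theorem bounded_of_growth {V : ℕ → ℕ} {s C₁ C₂ : ℕ} (he : Even s)
    (hup : ∀ n : ℕ, V n ≤ 3 ^ (3 ^ n + C₁))
    (hlow : ∀ n : ℕ, 3 ^ (s * 3 ^ n) ≤ V n * 3 ^ C₂)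
    (hup' : ∀ n : ℕ, V n ≤ 3 ^ (s * 3 ^ n + C₂)) :
    ∀ n : ℕ, V n ≤ 3 ^ C₂ := by
  have hrate : ∀ n : ℕ, s * 3 ^ n ≤ 3 ^ n + (C₁ + C₂) := by
    intro n
    have h : 3 ^ (s * 3 ^ n) ≤ 3 ^ (3 ^ n + C₁ + C₂) := by
      calc 3 ^ (s * 3 ^ n) ≤ V n * 3 ^ C₂ := hlow n
        _ ≤ 3 ^ (3 ^ n + C₁) * 3 ^ C₂ := Nat.mul_le_mul_right _ (hup n)
        _ = 3 ^ (3 ^ n + C₁ + C₂) := by rw [← pow_add]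
    have h' : s * 3 ^ n ≤ 3 ^ n + C₁ + C₂ := (Nat.pow_le_pow_iff_right (by norm_num)).mp h
    omega
  have hs : s = 0 := eq_zero_of_even_of_le_one he (rate_le_one hrate)
  intro n
  simpa [hs] using hup' n

/-- **The μ-half on the torsion locus from the pieces** (kernel): FINE + ISO + SYMP + EXH ⟹
`Sel_(∅,0)(K_∞, E[3^∞])[3]` finite whenever `X_(∅,0)` is `Λ`-torsion. [cite: GreenbergVatsal2000, §2 Prop. (2.8)] -/
theorem residualFiniteOnTorsion_of_pieces :
    FineResidualFiniteAtThreeSurj → IsotropyGrowthAtThree → SymplecticGrowthAtThree →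
      FiniteOfBoundedInvariantsAtThree → ResidualFiniteOnTorsionLocusAtThree := by
  intro hF hI hS hB W _ _ N _ K _ _ hO6 hsurj hr1 hN hK hH κ hκ γ _ 𝔭' h3' hT
  have hfine := hF W N K hO6 hsurj hr1 hN hK hH κ hκ
  obtain ⟨C₁, h₁⟩ := hI W N K hO6 hsurj hr1 hN hK hH κ hκ γ 𝔭' h3' hfine
  obtain ⟨s, C₂, he, h₂⟩ := hS W N K hO6 hsurj hr1 hN hK hH κ hκ γ 𝔭' h3' hT
  refine hB K (W.baseChange K) κ γ 𝔭' ⟨C₂, fun n ↦ ⟨(h₁ n).1, ?_⟩⟩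
  exact bounded_of_growth (V := fun n ↦ Nat.card (InvSet (W.baseChange K) κ 𝔭' γ n)) he
    (fun n ↦ (h₁ n).2) (fun n ↦ (h₂ n).2.1) (fun n ↦ (h₂ n).2.2) n

/-- **The wall from RATWALL + the μ-half on the torsion locus** (kernel; g10 road verbatim on the torsion locus,
the landed vacuity lemma off it). [cite: GreenbergVatsal2000, §2 Prop. (2.8)] [cite: Washington1997, §7.1, §13.2] -/
theorem wall_of_ratwall_of_residualFiniteOnTorsion :
    RationalSplitIMCInclusionAtThree → ResidualFiniteOnTorsionLocusAtThree → AdditiveSplitIMCInclusionAtThree := by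
  intro hR hF W _ _ N _ K _ _ Dt hO6 hsurj hr1 hN hK hH κ hκ γ _ 𝔭 h3 he hf 𝔭' h3' hne ι' hι ΩK Ωp L hΩK hΩp hL
  by_cases hT : Module.IsTorsion (IwasawaAlgebra 3) (XAc (W.baseChange K) 3 κ 𝔭' ∅ γ)
  · obtain ⟨k, hk⟩ := hR W N K Dt hO6 hsurj hr1 hN hK hH κ hκ γ 𝔭 h3 he hf 𝔭' h3' hne ι' hι ΩK Ωp L hΩK hΩp hL
    have hfin := hF W N K hO6 hsurj hr1 hN hK hH κ hκ γ 𝔭' h3' hT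
    obtain ⟨-, g, hg, i, hi⟩ :=
      isTorsion_and_exists_generator_of_finite_pTorsion (W.baseChange K) 3 κ 𝔭' ∅ γ Set.finite_empty hfin
    rw [hg] at hk ⊢
    have hdvd : g ∣ ((3 : ℕ) : UnrSeries 3) ^ k * L := Ideal.mem_span_singleton.mp hk
    rw [← map_natCast (PowerSeries.C (R := unrIntegers 3))] at hdvd
    exact Ideal.span_singleton_le_span_singleton.mpr
      (dvd_of_dvd_prime_pow_mul prime_C_three (not_C_three_dvd_of_norm_coeff_eq_one hi) k hdvd)
  · exact span_le_map_charIdeal_of_not_isTorsion hT _ L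

/-! ## §4 The five stubs of the node (the ONLY `sorry`s of this file) -/

/-- RATWALL (route crux 24207, WEAKER than the wall; LEAD line `thin_comb`). -/
theorem stub_ratwall : RationalSplitIMCInclusionAtThree := by
  sorry

/-- FINE — residual anticyclotomic fine-Selmer finiteness for `E` (WEAKER than the μ-half; IDEA-NEEDED leaf). -/
theorem stub_fine : FineResidualFiniteAtThreeSurj := by
  sorry

/-- ISO — Poitou–Tate isotropy growth bound (ATTACKABLE, pencil-proved). -/
theorem stub_isotropyGrowth : IsotropyGrowthAtThree := by
  sorry

/-- SYMP — Nekovář's symplectic structure for the conjugate pair (ATTACKABLE, print-adjacent). -/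
theorem stub_symplecticGrowth : SymplecticGrowthAtThree := by
  sorry

/-- EXH — discrete `Γ`-module exhaustion (ATTACKABLE, S). -/
theorem stub_finiteOfBoundedInvariants : FiniteOfBoundedInvariantsAtThree := by
  sorry

/-! ## §5 TOP composition: the crux BY NAME -/

/-- **The wall from RATWALL + FINE + ISO + SYMP + EXH.**  Concludes `AdditiveSplitIMCInclusionAtThree` BY NAME.
[cite: GreenbergVatsal2000, §2 Prop. (2.8)] [cite: Washington1997, §13.2] -/
theorem AdditiveSplitIMCInclusionAtThree_of :
    RationalSplitIMCInclusionAtThree → FineResidualFiniteAtThreeSurj → IsotropyGrowthAtThree →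
      SymplecticGrowthAtThree → FiniteOfBoundedInvariantsAtThree → AdditiveSplitIMCInclusionAtThree :=
  fun hR hF hI hS hB ↦
    wall_of_ratwall_of_residualFiniteOnTorsion hR (residualFiniteOnTorsion_of_pieces hF hI hS hB)

/-- The top composition run on the stubs: the crux BY NAME (sorries only through `stub_*`). -/
theorem AdditiveSplitIMCInclusionAtThree_holds_of_stubs : AdditiveSplitIMCInclusionAtThree :=
  AdditiveSplitIMCInclusionAtThree_of stub_ratwall stub_fine stub_isotropyGrowth stub_symplecticGrowth
    stub_finiteOfBoundedInvariants

/-- Converse bookkeeping (kernel, landed): the wall gives RATWALL back, so the node's surplus over 24207 is exactly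
the torsion-locus μ-half. [cite: Washington1997, §13.2] -/
theorem ratwall_of_wall : AdditiveSplitIMCInclusionAtThree → RationalSplitIMCInclusionAtThree :=
  Summit.BirchSwinnertonDyer.BirchSwinnertonDyer.Theorems.UniversalToricDescentRationalSplitIMCInclusionAtThreeOfWall.rationalSplitIMCInclusionAtThree_of_wall

end Summit.BirchSwinnertonDyer.BirchSwinnertonDyer.Cruxes.AdditiveSplitIMCInclusionAtThree.SymplecticIsotropyCut

end
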